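import Summits.CriticalPhenomena.PercolationContinuityZ3.Theorems.SahiCISCylinderConverse
import Mathlib.MeasureTheory.Constructions.Polish.Basic

/-!
# CIS (a.e.-kernel sense) is invariant under coordinatewise STRICTLY increasing maps — a copula property

Cell `prim-sahi`, typer (generation 17); `--supports stmt-CriticalPhenomena-4575`.  No named facts, no sorries.

`SahiCISMonotoneImage.lean` shows that a coordinatewise increasing but NON-INJECTIVE self-map of `[0,1]³` can destroy
CIS.  Here the positive half: for coordinatewise maps `x ↦ (φ_i(x_i))_i` with every `φ_i : [0,1] → [0,1]` STRICTLY
increasing (measurable embeddings that reflect the order), `IsCISae` is preserved in every dimension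
(**`IsCISae.map_coordMap`**).  So — as for association, MTP₂, … (Müller–Stoyan Thm. 3.10.19, the correct part) — CIS
in the a.e.-kernel sense depends only on the copula in the sense of order-isomorphic reparametrisations of the
coordinates.  Mechanism: the kernel of the image law is the image kernel read through a measurable left inverse of
the conditioning map (`Kernel.comap (κ.map φ_d) g`); disintegration by the change-of-variables formula on rectangles;
monotonicity on almost every pair pulls back along the measurable embedding `Φ × Φ`.

References: Müller–Stoyan 2002, Thm. 3.10.19 [MullerStoyan2002].  Statements are this work.
-/

noncomputable section

namespace Summit.CriticalPhenomena.PercolationContinuityZ3.Theorems.SahiCIS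

open MeasureTheory ProbabilityTheory Set Filter Topology Function
open Summit.CriticalPhenomena.PercolationContinuityZ3.Theorems.SahiBoxTP2
open scoped ENNReal unitInterval

variable {d : ℕ}

/-! ### Coordinatewise maps -/

/-- The coordinatewise map `x ↦ (φ_i (x_i))_i` of `Q_d`. [this work] -/
def coordMap (φ : Fin d → I → I) (x : Fin d → I) : Fin d → I := fun i => φ i (x i)

/-- Coordinatewise maps with measurable components are measurable. [folklore] -/
theorem measurable_coordMap {φ : Fin d → I → I} (hφ : ∀ i, Measurable (φ i)) : Measurable (coordMap φ) :=
  measurable_pi_iff.2 fun i => (hφ i).comp (measurable_pi_apply i)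

/-- Strictly increasing components: the map is an order embedding. [folklore] -/
theorem coordMap_le_iff {φ : Fin d → I → I} (hφ : ∀ i, StrictMono (φ i)) {x y : Fin d → I} :
    coordMap φ x ≤ coordMap φ y ↔ x ≤ y :=
  ⟨fun h i => (hφ i).le_iff_le.1 (h i), fun h i => (hφ i).monotone (h i)⟩

/-- Strictly increasing components: the map is injective. [folklore] -/
theorem injective_coordMap {φ : Fin d → I → I} (hφ : ∀ i, StrictMono (φ i)) : Injective (coordMap φ) :=
  fun _ _ h => funext fun i => (hφ i).injective (congrFun h i)

/-- Strictly increasing components: the map is a measurable embedding. [folklore] -/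
theorem measurableEmbedding_coordMap {φ : Fin d → I → I} (hφ : ∀ i, StrictMono (φ i)) :
    MeasurableEmbedding (coordMap φ) :=
  (measurable_coordMap fun i => (hφ i).monotone.measurable).measurableEmbedding (injective_coordMap hφ)

/-- The components over the first `d` coordinates. [this work] -/
def initComponents (φ : Fin (d + 1) → I → I) : Fin d → I → I := fun i => φ ((Fin.last d).succAbove i)

/-- Splitting off the last coordinate commutes with coordinatewise maps. [folklore] -/
theorem initLast_coordMap (φ : Fin (d + 1) → I → I) (x : Fin (d + 1) → I) :
    initLast (coordMap φ x) = (coordMap (initComponents φ) (initLast x).1, φ (Fin.last d) (initLast x).2) := rfl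

/-- The same as a composition. [folklore] -/
theorem initLast_comp_coordMap (φ : Fin (d + 1) → I → I) :
    initLast ∘ coordMap φ = Prod.map (coordMap (initComponents φ)) (φ (Fin.last d)) ∘ initLast :=
  funext fun x => initLast_coordMap φ x

/-! ### Lower sets and cdf domination on `[0,1]` -/

/-- On `[0,1]`: if `Q([0,x]) ≤ P([0,x])` for all `x`, then `Q(L) ≤ P(L)` for every measurable lower set `L`.
[folklore] -/
theorem measure_lowerSet_le_of_Iic_le (P Q : Measure I) [IsProbabilityMeasure P] [IsProbabilityMeasure Q]
    (h : ∀ x : I, Q (Iic x) ≤ P (Iic x)) {L : Set I} (hL : IsLowerSet L) (hLm : MeasurableSet L) : Q L ≤ P L := by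
  have hU := measure_upperSet_le_of_Iic_le P Q h hL.compl hLm.compl
  rw [prob_compl_eq_one_sub hLm, prob_compl_eq_one_sub hLm] at hU
  exact (ENNReal.sub_le_sub_iff_left prob_le_one ENNReal.one_ne_top).1 hU

/-! ### The image kernel -/

section Image

variable {μ : Measure (Fin (d + 1) → I)} {φ : Fin (d + 1) → I → I}

/-- The law of `((φ' x'), φ_d x_d)` is the image of the law of `(x', x_d)`. [folklore] -/
theorem map_coordMap_map_initLast (hφ : ∀ i, StrictMono (φ i)) :
    (μ.map (coordMap φ)).map initLast =
      (μ.map initLast).map (Prod.map (coordMap (initComponents φ)) (φ (Fin.last d))) := by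
  have hΦ : Measurable (coordMap φ) := measurable_coordMap fun i => (hφ i).monotone.measurable
  have hPm : Measurable (Prod.map (coordMap (initComponents φ)) (φ (Fin.last d))) :=
    (measurable_coordMap fun i => (hφ _).monotone.measurable).prodMap (hφ _).monotone.measurable
  rw [Measure.map_map measurable_initLast hΦ, initLast_comp_coordMap, ← Measure.map_map hPm measurable_initLast]

/-- Its first marginal is the image of the first marginal. [folklore] -/
theorem map_coordMap_map_initLast_fst (hφ : ∀ i, StrictMono (φ i)) :
    ((μ.map (coordMap φ)).map initLast).fst = ((μ.map initLast).fst).map (coordMap (initComponents φ)) := by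
  have hΦ' : Measurable (coordMap (initComponents φ)) := measurable_coordMap fun i => (hφ _).monotone.measurable
  have hψ : Measurable (φ (Fin.last d)) := (hφ _).monotone.measurable
  rw [map_coordMap_map_initLast hφ, Measure.fst, Measure.fst, Measure.map_map measurable_fst (hΦ'.prodMap hψ),
    Measure.map_map hΦ' measurable_fst]
  rfl

/-- **The image kernel disintegrates the image law and is stochastically increasing on almost every pair.**
[this work] -/
theorem exists_kernel_map_coordMap [IsProbabilityMeasure μ] (hφ : ∀ i, StrictMono (φ i)) (κ : Kernel (Fin d → I) I)
    [IsMarkovKernel κ]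
    (hdis : (μ.map initLast).fst ⊗ₘ κ = μ.map initLast) (hmono : AEPairMonoKernel (μ.map initLast).fst κ) :
    ∃ κ' : Kernel (Fin d → I) I, IsMarkovKernel κ' ∧
      ((μ.map (coordMap φ)).map initLast).fst ⊗ₘ κ' = (μ.map (coordMap φ)).map initLast ∧
      AEPairMonoKernel ((μ.map (coordMap φ)).map initLast).fst κ' := by
  classical
  set ν := (μ.map initLast).fst with hν
  set Φ' := coordMap (initComponents φ) with hΦ'
  set ψ := φ (Fin.last d) with hψdef
  have hφ' : ∀ i, StrictMono (initComponents φ i) := fun i => hφ _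
  have hΦ'e : MeasurableEmbedding Φ' := measurableEmbedding_coordMap hφ'
  have hΦ'm : Measurable Φ' := hΦ'e.measurable
  have hψm : Measurable ψ := (hφ _).monotone.measurable
  -- a measurable left inverse of `Φ'`
  set g : (Fin d → I) → (Fin d → I) := Function.extend Φ' id (fun _ => fun _ => ⊥) with hg
  have hgm : Measurable g := hΦ'e.measurable_extend measurable_id measurable_const
  have hgΦ : ∀ a, g (Φ' a) = a := fun a => (injective_coordMap hφ').extend_apply _ _ a
  haveI : IsMarkovKernel (κ.map ψ) := Kernel.IsMarkovKernel.map κ hψm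
  set κ' : Kernel (Fin d → I) I := Kernel.comap (κ.map ψ) g hgm with hκ'
  have hκ'Φ : ∀ a, ∀ {B : Set I}, MeasurableSet B → κ' (Φ' a) B = κ a (ψ ⁻¹' B) := fun a B hB => by
    rw [hκ', Kernel.comap_apply, hgΦ, Kernel.map_apply' κ hψm a hB]
  refine ⟨κ', inferInstance, ?_, ?_⟩
  · -- disintegration, checked on rectangles
    rw [map_coordMap_map_initLast_fst hφ, map_coordMap_map_initLast hφ]
    haveI : IsProbabilityMeasure (ν.map Φ') := Measure.isProbabilityMeasure_map hΦ'm.aemeasurable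
    haveI : IsProbabilityMeasure (μ.map initLast) := inferInstance
    haveI : IsProbabilityMeasure ((μ.map initLast).map (Prod.map Φ' ψ)) :=
      Measure.isProbabilityMeasure_map (hΦ'm.prodMap hψm).aemeasurable
    refine ext_of_generate_finite _ generateFrom_prod.symm isPiSystem_prod (fun s hs => ?_) ?_
    · obtain ⟨S, hS, B, hB, rfl⟩ := hs
      have hS' : MeasurableSet S := hS
      have hB' : MeasurableSet B := hB
      rw [Measure.compProd_apply_prod hS' hB', setLIntegral_map hS' (κ'.measurable_coe hB') hΦ'm,
        Measure.map_apply (hΦ'm.prodMap hψm) (hS'.prod hB'), Set.preimage_prod_map_prod, ← hdis, Measure.fst_compProd,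
        Measure.compProd_apply_prod (hΦ'm hS') (hψm hB')]
      exact setLIntegral_congr_fun (hΦ'm hS') fun a _ => hκ'Φ a hB'
    · rw [measure_univ, measure_univ]
  · -- monotone on almost every pair
    rw [map_coordMap_map_initLast_fst hφ]
    change ∀ᵐ p ∂((ν.map Φ').prod (ν.map Φ')), p.1 ≤ p.2 → ∀ x : I, κ' p.2 (Iic x) ≤ κ' p.1 (Iic x)
    rw [Measure.map_prod_map ν ν hΦ'm hΦ'm, (hΦ'e.prodMap hΦ'e).ae_map_iff]
    filter_upwards [hmono] with p hp hle x
    have hle' : p.1 ≤ p.2 := (coordMap_le_iff hφ').1 hle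
    change κ' (Φ' p.2) (Iic x) ≤ κ' (Φ' p.1) (Iic x)
    rw [hκ'Φ p.2 measurableSet_Iic, hκ'Φ p.1 measurableSet_Iic]
    haveI : IsProbabilityMeasure (κ p.1) := IsMarkovKernel.isProbabilityMeasure p.1
    haveI : IsProbabilityMeasure (κ p.2) := IsMarkovKernel.isProbabilityMeasure p.2
    exact measure_lowerSet_le_of_Iic_le (κ p.1) (κ p.2) (hp hle') (fun u v hvu hu =>
      show ψ v ≤ x from ((hφ _).monotone hvu).trans hu) (hψm measurableSet_Iic)

end Image

/-! ### The invariance theorem -/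

/-- **CIS (a.e.-kernel sense) is preserved by coordinatewise strictly increasing maps**, every dimension.
[this work] -/
theorem IsCISae.map_coordMap : ∀ (d : ℕ) (μ : Measure (Fin d → I)) [IsProbabilityMeasure μ]
    (φ : Fin d → I → I), (∀ i, StrictMono (φ i)) → IsCISae d μ → IsCISae d (μ.map (coordMap φ)) := by
  intro d
  induction d with
  | zero => intro μ _ φ _ _; trivial
  | succ d ih =>
    intro μ _ φ hφ hμ
    obtain ⟨h1, κ, hκ, hdis, hmono⟩ := hμ
    obtain ⟨κ', hκ', hdis', hmono'⟩ := exists_kernel_map_coordMap hφ κ hdis hmono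
    refine ⟨?_, κ', hκ', hdis', hmono'⟩
    rw [map_coordMap_map_initLast_fst hφ]
    exact ih _ (initComponents φ) (fun i => hφ _) h1

end Summit.CriticalPhenomena.PercolationContinuityZ3.Theorems.SahiCIS

end
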